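import Mathlib
import Summits.ResolutionOfSingularities.ResolutionOfSingularities.Theorems.WildQuotientsWildQuotientResolutionJordanFiveChartW1Model
import Summits.ResolutionOfSingularities.ResolutionOfSingularities.Theorems.WildQuotientsWildQuotientResolutionJordanFourChartTTwistedModel

/-!
# RUNG V5 (J₅) — `eE` on the sections over `W₁ = D₊(H′²t·T′²H′t²)`, in the letters of the ring brick (any model `L` of `k[x][1/Q]`, `E = k[cone][1/Q]`)

(crux stmt-ResolutionOfSingularities-15640 `WildQuotients.WildQuotientResolution`, line `Sketch`;
chain w45c RUNG V5 HP₁: res-L1-w45c-plan-1 NAMED 2026-08-27T11:35:13Z / CHAIN v8.4 §4 (H₁ = stub-1;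
X1 ring model = res-L1-w45c-stub-2, `JordanFive.exists_ringBrick_X1_model` p531492; seam W₁ =
res-L1-w45c-stub-5, `JordanFive.exists_sectionsEquiv_chartW₁` p527645). J₅ twin of this seat's
`JordanFour.exists_chartW_away_ringEquiv_evenModel` (p514513). [OURS · L1 W4.5c] — NOT a statement
of any manuscript (Hironaka 2017 is consumed nowhere); replaces the role of no printed item. Prover
res-L1-w45c-stub-1. AI-written Lean, kernel-checked; weaker than expert review.)

* `isLocalization_away_theta_chartW₁` — `(k[x][I₁₂t])_{(H′²t·T′²H′t²)}` IS a localisation of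
  `B₁ = (k[x][I₁₂t])_{(H′²t)}` at `θ₁ = (T′²H′t²)/(H′²t)²` (Mathlib `Away.isLocalization_mul`).
* **`exists_chartW₁Sections_ringEquiv_cubicModel`** — for ANY `L` with
  `IsLocalization.Away (JordanFour.twistedQ k n a b d) L`:
  `(k[x][I₁₂t])_{(H′²t·T′²H′t²)} ≃+* E`, `E = Algebra.adjoin k (algebraMap '' ThirdCone.cone (cubicWeight)
  ∪ {invSelf (twistedQ)})` (the `hE` of p531492 VERBATIM), with `fromZero∘zero F ↦ ψ₅ F` (the `hbase`
  of p531492 with `base := fromZeroRingHom ∘ zeroRingHom`), the chart ratios `(g_jt)/(H′²t) ↦ q_j·Q⁻²`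
  and `θ₁ ↦ Q⁻¹`.
-/

-- single-problem summit: the doubled namespace component `ResolutionOfSingularities` is forced
set_option linter.dupNamespace false

noncomputable section

open MvPolynomial Literature.AlgebraicGeometry.Resolution

namespace Summit.ResolutionOfSingularities.ResolutionOfSingularities.Theorems.WildQuotientResolution.JordanFive

section SectionsModel

variable (k : Type) [Field k] (n : ℕ) (a b c d e : Fin n)
  (hab : a ≠ b) (hac : a ≠ c) (had : a ≠ d) (hae : a ≠ e) (hbc : b ≠ c) (hbd : b ≠ d) (hbe : b ≠ e)
  (hcd : c ≠ d) (hce : c ≠ e) (hde : d ≠ e)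

local notation3 "Qp" => (1 - 3 * X b * X a + X a ^ 2 * X d : MvPolynomial (Fin n) k)
local notation3 "LQ" => Localization.Away Qp
local notation3 "B₁" => HomogeneousLocalization.Away (reesGrading (I12 k n a b c d))
  (reesT (JordanFour.hPrime k n a b c ^ 2) (hPrime_sq_mem_I12 k n a b c d))
local notation3 (prettyPrint := false) "θ₁" =>
  HomogeneousLocalization.Away.mk (reesGrading (I12 k n a b c d))
    (reesT_mem (JordanFour.hPrime k n a b c ^ 2) (hPrime_sq_mem_I12 k n a b c d)) 2
    (tSqHT2 k n a b c d) (tSqHT2_mem k n a b c d)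
local notation3 "BW₁" => HomogeneousLocalization.Away (reesGrading (I12 k n a b c d))
  (reesT (JordanFour.hPrime k n a b c ^ 2) (hPrime_sq_mem_I12 k n a b c d) * tSqHT2 k n a b c d)
local notation3 "Sset" => (Set.range (fun v : ThirdCone.VIdx n (cubicWeight n a b c d) =>
    ((ThirdCone.vertexGen k n (cubicWeight n a b c d) v : ThirdCone.cone k n (cubicWeight n a b c d)) :
      MvPolynomial (Fin n) k)) ∪
  (fun i : Fin n => (X i : MvPolynomial (Fin n) k)) '' {i | cubicWeight n a b c d i = 0})
local notation3 "E₁" => Algebra.adjoin k ((algebraMap (MvPolynomial (Fin n) k) LQ) '' Sset ∪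
    {(IsLocalization.Away.invSelf Qp : LQ)})

/-- Mathlib's localisation element `(T′²H′t²)^1/(H′²t)^2` of `Away.isLocalization_mul` IS `θ₁`.
[folklore] -/
theorem isLocalizationElem_eq_theta₁ :
    HomogeneousLocalization.Away.isLocalizationElem (𝒜 := reesGrading (I12 k n a b c d))
        (reesT_mem (JordanFour.hPrime k n a b c ^ 2) (hPrime_sq_mem_I12 k n a b c d))
        (tSqHT2_mem k n a b c d) = (θ₁ : B₁) := by
  unfold HomogeneousLocalization.Away.isLocalizationElem
  congr 1
  exact pow_one _

/-- **`(k[x][I₁₂t])_{(H′²t·T′²H′t²)}` is a localisation of `B₁` at `θ₁`** along Mathlib's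
`HomogeneousLocalization.awayMap` (`Away.isLocalization_mul`, degrees `1` and `2`). [folklore] -/
theorem isLocalization_away_theta_chartW₁ :
    letI := (HomogeneousLocalization.awayMap (reesGrading (I12 k n a b c d)) (tSqHT2_mem k n a b c d)
      (rfl : reesT (JordanFour.hPrime k n a b c ^ 2) (hPrime_sq_mem_I12 k n a b c d) * tSqHT2 k n a b c d = _)).toAlgebra
    IsLocalization.Away (θ₁ : B₁) BW₁ := by
  rw [← isLocalizationElem_eq_theta₁]
  exact HomogeneousLocalization.Away.isLocalization_mul (𝒜 := reesGrading (I12 k n a b c d))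
    (reesT_mem (JordanFour.hPrime k n a b c ^ 2) (hPrime_sq_mem_I12 k n a b c d)) (tSqHT2_mem k n a b c d) rfl
    one_ne_zero

/-- The literal generator set `Sset` lies in the cubic cone. [OURS · L1 W4.5c] -/
theorem sset_subset_cone :
    Sset ⊆ (ThirdCone.cone k n (cubicWeight n a b c d) : Set (MvPolynomial (Fin n) k)) := by
  intro x hx
  have hx' : x ∈ Algebra.adjoin k Sset := Algebra.subset_adjoin hx
  rwa [adjoin_vertexGen_eq_cone] at hx'

include hab hac had hae hbc hbd hbe hcd hce hde in
/-- **`eE` on the sections over `W₁`, in the ring brick's letters.** For ANY `L` with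
`IsLocalization.Away (twistedQ k n a b d) L` and `E = k[ThirdCone.cone (cubicWeight)][Q⁻¹] ⊆ L`
(p531492's `hE`): `(k[x][I₁₂t])_{(H′²t·T′²H′t²)} ≃+* E` with `fromZero∘zero F ↦ ψ₅ F`,
`(g_jt)/(H′²t) ↦ q_j·Q⁻²`, `θ₁ ↦ Q⁻¹` (`char k ≥ 5`). [OURS · L1 W4.5c] -/
theorem exists_chartW₁Sections_ringEquiv_cubicModel (h2 : (2 : k) ≠ 0) (h3 : (3 : k) ≠ 0)
    (L : Type) [CommRing L] [Algebra k L] [Algebra (MvPolynomial (Fin n) k) L]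
    [IsScalarTower k (MvPolynomial (Fin n) k) L] [IsLocalization.Away (JordanFour.twistedQ k n a b d) L] :
    ∃ eE : BW₁ ≃+* ↥(Algebra.adjoin k (algebraMap (MvPolynomial (Fin n) k) L ''
        (ThirdCone.cone k n (cubicWeight n a b c d) : Set (MvPolynomial (Fin n) k)) ∪
        {IsLocalization.Away.invSelf (S := L) (JordanFour.twistedQ k n a b d)})),
      (∀ F : MvPolynomial (Fin n) k,
        ((eE (HomogeneousLocalization.fromZeroRingHom (reesGrading (I12 k n a b c d)) _
          (reesGrading.zeroRingHom (I12 k n a b c d) F)) : _) : L) =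
          algebraMap (MvPolynomial (Fin n) k) L (twistedChart k n a b c d e F)) ∧
      (∀ j : Fin 40,
        ((eE (HomogeneousLocalization.awayMap (reesGrading (I12 k n a b c d)) (tSqHT2_mem k n a b c d)
          (rfl : reesT (JordanFour.hPrime k n a b c ^ 2) (hPrime_sq_mem_I12 k n a b c d) * tSqHT2 k n a b c d = _)
          (HomogeneousLocalization.Away.mk (reesGrading (I12 k n a b c d))
            (reesT_mem (JordanFour.hPrime k n a b c ^ 2) (hPrime_sq_mem_I12 k n a b c d)) 1
            (reesT (gens12 k n a b c d j) (Ideal.mem_span_range_self (f := gens12 k n a b c d) (x := j)))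
            (reesT_mem_one_smul (gens12 k n a b c d) j))) : _) : L) =
          algebraMap (MvPolynomial (Fin n) k) L (twistedCofactor12 k n a b c d j) *
            IsLocalization.Away.invSelf (S := L) (JordanFour.twistedQ k n a b d) ^ 2) ∧
      ((eE (HomogeneousLocalization.awayMap (reesGrading (I12 k n a b c d)) (tSqHT2_mem k n a b c d)
          (rfl : reesT (JordanFour.hPrime k n a b c ^ 2) (hPrime_sq_mem_I12 k n a b c d) * tSqHT2 k n a b c d = _)
          (θ₁ : B₁)) : _) : L) =
        IsLocalization.Away.invSelf (S := L) (JordanFour.twistedQ k n a b d) := by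
  have hQ := twistedQ_eq_literal k n a b d
  -- `L` is also a localisation at the literal `Qp`
  haveI hL : IsLocalization.Away Qp L := by rw [← hQ]; infer_instance
  -- the transport `φ : k[x][1/Qp] ≃ₐ[k] L`
  obtain ⟨φ, hφalg, hφinv⟩ : ∃ φ : LQ ≃ₐ[k] L,
      (∀ f : MvPolynomial (Fin n) k,
        φ (algebraMap (MvPolynomial (Fin n) k) LQ f) = algebraMap (MvPolynomial (Fin n) k) L f) ∧
      φ (IsLocalization.Away.invSelf (S := LQ) Qp) =
        IsLocalization.Away.invSelf (S := L) (JordanFour.twistedQ k n a b d) := by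
    let φ₀ : LQ ≃ₐ[MvPolynomial (Fin n) k] L := IsLocalization.algEquiv (Submonoid.powers Qp) LQ L
    have hφalg : ∀ f : MvPolynomial (Fin n) k, φ₀.restrictScalars k (algebraMap (MvPolynomial (Fin n) k) LQ f) =
        algebraMap (MvPolynomial (Fin n) k) L f := fun f => φ₀.commutes f
    refine ⟨φ₀.restrictScalars k, hφalg, ?_⟩
    have h1 : algebraMap (MvPolynomial (Fin n) k) L (JordanFour.twistedQ k n a b d) *
        φ₀.restrictScalars k (IsLocalization.Away.invSelf (S := LQ) Qp) = 1 := by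
      rw [hQ, ← hφalg, ← map_mul, IsLocalization.Away.mul_invSelf, map_one]
    have h2' : IsLocalization.Away.invSelf (S := L) (JordanFour.twistedQ k n a b d) *
        algebraMap (MvPolynomial (Fin n) k) L (JordanFour.twistedQ k n a b d) = 1 := by
      rw [mul_comm]; exact IsLocalization.Away.mul_invSelf _
    exact (left_inv_eq_right_inv h2' h1).symm
  -- the image of `E₁` is `E`
  have hmap : (E₁).map (φ : LQ →ₐ[k] L) =
      Algebra.adjoin k (algebraMap (MvPolynomial (Fin n) k) L ''
        (ThirdCone.cone k n (cubicWeight n a b c d) : Set (MvPolynomial (Fin n) k)) ∪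
        {IsLocalization.Away.invSelf (S := L) (JordanFour.twistedQ k n a b d)}) := by
    rw [AlgHom.map_adjoin, Set.image_union, Set.image_singleton, Set.image_image, AlgEquiv.coe_toAlgHom,
      hφinv]
    have himg : (fun x => φ (algebraMap (MvPolynomial (Fin n) k) LQ x)) '' Sset =
        algebraMap (MvPolynomial (Fin n) k) L '' Sset := Set.image_congr fun f _ => hφalg f
    rw [himg]
    apply le_antisymm
    · exact Algebra.adjoin_mono (Set.union_subset_union_left _
        (Set.image_mono (sset_subset_cone k n a b c d)))
    · refine Algebra.adjoin_le (Set.union_subset ?_ ?_)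
      · rintro _ ⟨f, hf, rfl⟩
        have hf' : f ∈ Algebra.adjoin k Sset := by rwa [adjoin_vertexGen_eq_cone]
        have hmem : (IsScalarTower.toAlgHom k (MvPolynomial (Fin n) k) L) f ∈
            (Algebra.adjoin k Sset).map (IsScalarTower.toAlgHom k (MvPolynomial (Fin n) k) L) :=
          Subalgebra.mem_map.mpr ⟨f, hf', rfl⟩
        rw [AlgHom.map_adjoin] at hmem
        exact Algebra.adjoin_mono Set.subset_union_left hmem
      · exact Set.singleton_subset_iff.mpr (Algebra.subset_adjoin (Set.mem_union_right _ rfl))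
  obtain ⟨eφ, heφ⟩ := JordanFour.exists_subalgebra_ringEquiv_of_map_eq φ _ _ hmap
  -- the engine instance on `BW₁` (explicit `B₁`-algebra structure along `awayMap`)
  letI := (HomogeneousLocalization.awayMap (reesGrading (I12 k n a b c d)) (tSqHT2_mem k n a b c d)
      (rfl : reesT (JordanFour.hPrime k n a b c ^ 2) (hPrime_sq_mem_I12 k n a b c d) * tSqHT2 k n a b c d = _)).toAlgebra
  have hmain := @exists_chartW₁_away_ringEquiv k _ n a b c d e hab hac had hae hbc hbd hbe hcd hce hde h2 h3
    BW₁ _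
    ((HomogeneousLocalization.awayMap (reesGrading (I12 k n a b c d)) (tSqHT2_mem k n a b c d)
      (rfl : reesT (JordanFour.hPrime k n a b c ^ 2) (hPrime_sq_mem_I12 k n a b c d) * tSqHT2 k n a b c d = _)).toAlgebra)
    (isLocalization_away_theta_chartW₁ k n a b c d)
  obtain ⟨e₀, he1, he2, he3⟩ := hmain
  refine ⟨e₀.trans eφ, fun F => ?_, fun j => ?_, ?_⟩
  · rw [RingEquiv.trans_apply, heφ, ← JordanFour.awayMap_reesChartBase (JordanFour.hPrime k n a b c ^ 2)
      (hPrime_sq_mem_I12 k n a b c d) (tSqHT2_mem k n a b c d)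
      (rfl : reesT (JordanFour.hPrime k n a b c ^ 2) (hPrime_sq_mem_I12 k n a b c d) * tSqHT2 k n a b c d = _) F]
    have h := he1 F
    rw [RingHom.algebraMap_toAlgebra] at h
    rw [h, hφalg]
  · rw [RingEquiv.trans_apply, heφ]
    have h := he2 j
    rw [RingHom.algebraMap_toAlgebra] at h
    rw [h, map_mul, map_pow, hφalg, hφinv]
  · rw [RingEquiv.trans_apply, heφ]
    have h := he3
    rw [RingHom.algebraMap_toAlgebra] at h
    rw [h, hφinv]

end SectionsModel

end Summit.ResolutionOfSingularities.ResolutionOfSingularities.Theorems.WildQuotientResolution.JordanFive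

end
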